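import Mathlib
import Literature.Analysis.ValidatedNumerics.ConeDirichletInverseSemantics
import HarnessLib

/-!
# Column functions of the cone Dirichlet inverse along real lines: derivatives, disk bounds, the Laplacian identity

Topic `Literature/Analysis/ValidatedNumerics`.  Technical layer for the interior semantics of
`Δ_D⁻¹ = ConeSemilinear.dirInv` (`ConeDirichletInverseInterior.lean`): the disk monomials
`M_{p,q}(w) = w^p w̄^q` and the column functions `w_m = ConeEval.colFun m` of the Dirichlet-inverse kernel
(`ConeDirichletInverseSemantics.lean`) restricted to a real line `t ↦ z + tc`:

* `mpath`, `mpathD1`, `mpathD2`, `hasDerivAt_mpath`, `hasDerivAt_mpathD1` — explicit first and second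
  `t`-derivatives of `M_{p,q}(z + tc)`; disk bounds `|∂_t| ≤ p + q`, `|∂²_t| ≤ (p+q)²` when `|z + tc| ≤ 1`,
  `|c| ≤ 1` (`norm_mpathD1_le`, `norm_mpathD2_le`); the Laplacian identity
  `∂²_t M_{p,q}(z+t)|₀ + ∂²_t M_{p,q}(z+tI)|₀ = 4pq z^{p−1} z̄^{q−1}` (`mpathD2_one_add_I`, the content of
  `ConeMonomial.lapRI_monomial` for the explicit formulas);
* `colPath m z c t = w_m(z + tc)` (`colPath_eq_colFun`) with derivatives `colPathD1/2`
  (`hasDerivAt_colPath`, `hasDerivAt_colPathD1`) and the bounds **`|w_m| ≤ 1/2`, `|∂_t w_m| ≤ 1`,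
  `|∂²_t w_m| ≤ a + b + 2`** on the disk (`norm_colPath_le`, `norm_colPathD1_le`, `norm_colPathD2_le`; the
  factor `1/(4(a+1)(b+1))` turns quadratic growth into linear, `invFactor_mul_deg_le`); the column identity
  **`∂²_t w_m(z+t)|₀ + ∂²_t w_m(z+tI)|₀ = z^a z̄^b`** (`colPathD2_one_add_I`: `Δ` of the raised monomial is
  `4(a+1)(b+1) z^a z̄^b`, the harmonic correction is a pure power, `harmIndex_mul_eq_zero`);
* `deg_add_two_le_weight` — Bernoulli: `n + 2 ≤ (1/(ϱ−1) + 2) ϱ^n` for `ϱ > 1` (linear growth is dominated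
  by the weight, which is what makes the second termwise derivative summable).

## Sources

[ArioliKoch2019] §2 eqs. (2.7)–(2.10) (calculus of `z, z̄` on disk polynomials; `Δ = 4∂_z∂_z̄`), Lemma 2.1
(termwise Dirichlet inverse), §3 Lemma 3.1 (`ρ > 1`: extra regularity).  Monomial version.

## What is NOT covered

Anything about infinite families (next file); float model.

## Provenance

AI-produced formalisation (cell certnum, seat certnum-ode-2, 2026-08-27).
-/

set_option autoImplicit false

open scoped BigOperators Topology
open Complex Filter Set

noncomputable section

namespace Literature.Analysis.ValidatedNumerics

namespace ConeEval

open WeightedSeq WienerAlgebra ConeMonomial ConeSemilinear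

/-! ### §1. The monomial along a real line: first and second derivatives, bounds on the disk -/

/-- `M_{p,q}` along the line `t ↦ z + t c`: `(z + tc)^p (z̄ + t c̄)^q` (real `t`).
[cite: ArioliKoch2019, §2 eq. (2.7) (z, z̄ as variables)] -/
def mpath (p q : ℕ) (z c : ℂ) (t : ℝ) : ℂ :=
  (z + (t : ℂ) * c) ^ p * (starRingEnd ℂ z + (t : ℂ) * starRingEnd ℂ c) ^ q

/-- Its first derivative in `t`. [cite: ArioliKoch2019, §2 eq. (2.7)] -/
def mpathD1 (p q : ℕ) (z c : ℂ) (t : ℝ) : ℂ :=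
  (p : ℂ) * c * (z + (t : ℂ) * c) ^ (p - 1) * (starRingEnd ℂ z + (t : ℂ) * starRingEnd ℂ c) ^ q
  + (q : ℂ) * starRingEnd ℂ c * (z + (t : ℂ) * c) ^ p
      * (starRingEnd ℂ z + (t : ℂ) * starRingEnd ℂ c) ^ (q - 1)

/-- Its second derivative in `t`. [cite: ArioliKoch2019, §2 eq. (2.7)] -/
def mpathD2 (p q : ℕ) (z c : ℂ) (t : ℝ) : ℂ :=
  (p : ℂ) * ((p - 1 : ℕ) : ℂ) * c ^ 2 * (z + (t : ℂ) * c) ^ (p - 1 - 1)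
      * (starRingEnd ℂ z + (t : ℂ) * starRingEnd ℂ c) ^ q
  + 2 * (p : ℂ) * (q : ℂ) * c * starRingEnd ℂ c * (z + (t : ℂ) * c) ^ (p - 1)
      * (starRingEnd ℂ z + (t : ℂ) * starRingEnd ℂ c) ^ (q - 1)
  + (q : ℂ) * ((q - 1 : ℕ) : ℂ) * starRingEnd ℂ c ^ 2 * (z + (t : ℂ) * c) ^ p
      * (starRingEnd ℂ z + (t : ℂ) * starRingEnd ℂ c) ^ (q - 1 - 1)

/-- The monomial along the line IS `M_{p,q}(z + tc)` (`conj (z + tc) = z̄ + t c̄` for real `t`).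
[cite: ArioliKoch2019, §2 eq. (2.7)] -/
theorem mpath_eq (p q : ℕ) (z c : ℂ) (t : ℝ) : mpath p q z c t = monomial p q (z + (t : ℂ) * c) := by
  unfold mpath monomial
  rw [map_add, map_mul, Complex.conj_ofReal]

/-- [folklore] -/
private theorem hasDerivAt_lin (z c : ℂ) (t : ℝ) : HasDerivAt (fun s : ℝ => z + (s : ℂ) * c) c t := by
  have h1 : HasDerivAt (fun s : ℝ => ((s : ℝ) : ℂ)) ((1 : ℝ) : ℂ) t := (hasDerivAt_id t).ofReal_comp
  simpa using (h1.mul_const c).const_add z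

/-- [folklore] -/
private theorem hasDerivAt_pow_lin (z c : ℂ) (n : ℕ) (t : ℝ) :
    HasDerivAt (fun s : ℝ => (z + (s : ℂ) * c) ^ n) ((n : ℂ) * (z + (t : ℂ) * c) ^ (n - 1) * c) t :=
  (hasDerivAt_lin z c t).pow n

/-- `d/dt M_{p,q}(z+tc) = mpathD1`. [cite: ArioliKoch2019, §2 eq. (2.7)–(2.8) (∂_z, ∂_z̄ of monomials)] -/
theorem hasDerivAt_mpath (p q : ℕ) (z c : ℂ) (t : ℝ) :
    HasDerivAt (mpath p q z c) (mpathD1 p q z c t) t := by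
  have h := (hasDerivAt_pow_lin z c p t).mul (hasDerivAt_pow_lin (starRingEnd ℂ z) (starRingEnd ℂ c) q t)
  refine h.congr_deriv ?_
  unfold mpathD1
  ring

/-- `d/dt mpathD1 = mpathD2`. [cite: ArioliKoch2019, §2 eq. (2.7)–(2.8)] -/
theorem hasDerivAt_mpathD1 (p q : ℕ) (z c : ℂ) (t : ℝ) :
    HasDerivAt (mpathD1 p q z c) (mpathD2 p q z c t) t := by
  have hA := ((hasDerivAt_pow_lin z c (p - 1) t).const_mul ((p : ℂ) * c)).mul
    (hasDerivAt_pow_lin (starRingEnd ℂ z) (starRingEnd ℂ c) q t)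
  have hB := ((hasDerivAt_pow_lin z c p t).const_mul ((q : ℂ) * starRingEnd ℂ c)).mul
    (hasDerivAt_pow_lin (starRingEnd ℂ z) (starRingEnd ℂ c) (q - 1) t)
  have h := hA.add hB
  refine (h.congr_of_eventuallyEq ?_).congr_deriv ?_
  · exact Filter.Eventually.of_forall fun s => by
      simp only [Pi.add_apply, Pi.mul_apply, mpathD1]
  · unfold mpathD2
    ring

/-- On the closed unit disk, `|z + tc|^n ≤ 1`. [cite: ArioliKoch2019, §3 eq. (3.2)] -/
private theorem norm_pow_le_one_of {w : ℂ} (hw : ‖w‖ ≤ 1) (n : ℕ) : ‖w ^ n‖ ≤ 1 := by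
  rw [norm_pow]; exact pow_le_one₀ (norm_nonneg _) hw

/-- **First-derivative bound on the disk:** `|d/dt M_{p,q}(z+tc)| ≤ p + q` when `|z + tc| ≤ 1`, `|c| ≤ 1`.
[cite: ArioliKoch2019, §3 Lemma 3.1 (regularity of the functions of A_ρ)] -/
theorem norm_mpathD1_le (p q : ℕ) {z c : ℂ} {t : ℝ} (hw : ‖z + (t : ℂ) * c‖ ≤ 1) (hc : ‖c‖ ≤ 1) :
    ‖mpathD1 p q z c t‖ ≤ (p : ℝ) + q := by
  have hw' : ‖starRingEnd ℂ z + (t : ℂ) * starRingEnd ℂ c‖ ≤ 1 := by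
    rw [← Complex.conj_ofReal, ← map_mul, ← map_add, Complex.norm_conj]; exact hw
  have hc' : ‖starRingEnd ℂ c‖ ≤ 1 := by rw [Complex.norm_conj]; exact hc
  unfold mpathD1
  refine (norm_add_le _ _).trans (add_le_add ?_ ?_)
  · rw [norm_mul, norm_mul, norm_mul, Complex.norm_natCast]
    calc (p : ℝ) * ‖c‖ * ‖(z + (t : ℂ) * c) ^ (p - 1)‖ * ‖(starRingEnd ℂ z + (t : ℂ) * starRingEnd ℂ c) ^ q‖
        ≤ (p : ℝ) * 1 * 1 * 1 := by
          gcongr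
          · exact norm_pow_le_one_of hw _
          · exact norm_pow_le_one_of hw' _
      _ = p := by ring
  · rw [norm_mul, norm_mul, norm_mul, Complex.norm_natCast]
    calc (q : ℝ) * ‖starRingEnd ℂ c‖ * ‖(z + (t : ℂ) * c) ^ p‖
          * ‖(starRingEnd ℂ z + (t : ℂ) * starRingEnd ℂ c) ^ (q - 1)‖
        ≤ (q : ℝ) * 1 * 1 * 1 := by
          gcongr
          · exact norm_pow_le_one_of hw _
          · exact norm_pow_le_one_of hw' _
      _ = q := by ring

/-- **Second-derivative bound on the disk:** `|d²/dt² M_{p,q}(z+tc)| ≤ (p + q)²` when `|z + tc| ≤ 1`,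
`|c| ≤ 1` (`p(p−1) + 2pq + q(q−1) ≤ (p+q)²`).
[cite: ArioliKoch2019, §3 Lemma 3.1 (regularity of the functions of A_ρ)] -/
theorem norm_mpathD2_le (p q : ℕ) {z c : ℂ} {t : ℝ} (hw : ‖z + (t : ℂ) * c‖ ≤ 1) (hc : ‖c‖ ≤ 1) :
    ‖mpathD2 p q z c t‖ ≤ ((p : ℝ) + q) ^ 2 := by
  have hw' : ‖starRingEnd ℂ z + (t : ℂ) * starRingEnd ℂ c‖ ≤ 1 := by
    rw [← Complex.conj_ofReal, ← map_mul, ← map_add, Complex.norm_conj]; exact hw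
  have hc' : ‖starRingEnd ℂ c‖ ≤ 1 := by rw [Complex.norm_conj]; exact hc
  have hp1 : ((p - 1 : ℕ) : ℝ) ≤ p := by exact_mod_cast Nat.sub_le p 1
  have hq1 : ((q - 1 : ℕ) : ℝ) ≤ q := by exact_mod_cast Nat.sub_le q 1
  unfold mpathD2
  refine (norm_add₃_le).trans ?_
  have e1 : ‖(p : ℂ) * ((p - 1 : ℕ) : ℂ) * c ^ 2 * (z + (t : ℂ) * c) ^ (p - 1 - 1)
      * (starRingEnd ℂ z + (t : ℂ) * starRingEnd ℂ c) ^ q‖ ≤ (p : ℝ) * p := by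
    rw [norm_mul, norm_mul, norm_mul, norm_mul, Complex.norm_natCast, Complex.norm_natCast]
    calc (p : ℝ) * ((p - 1 : ℕ) : ℝ) * ‖c ^ 2‖ * ‖(z + (t : ℂ) * c) ^ (p - 1 - 1)‖
          * ‖(starRingEnd ℂ z + (t : ℂ) * starRingEnd ℂ c) ^ q‖
        ≤ (p : ℝ) * p * 1 * 1 * 1 := by
          gcongr
          · exact norm_pow_le_one_of hc 2
          · exact norm_pow_le_one_of hw _
          · exact norm_pow_le_one_of hw' _
      _ = (p : ℝ) * p := by ring
  have e2 : ‖2 * (p : ℂ) * (q : ℂ) * c * starRingEnd ℂ c * (z + (t : ℂ) * c) ^ (p - 1)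
      * (starRingEnd ℂ z + (t : ℂ) * starRingEnd ℂ c) ^ (q - 1)‖ ≤ 2 * (p : ℝ) * q := by
    rw [norm_mul, norm_mul, norm_mul, norm_mul, norm_mul, norm_mul, Complex.norm_natCast,
      Complex.norm_natCast, Complex.norm_two]
    calc 2 * (p : ℝ) * q * ‖c‖ * ‖starRingEnd ℂ c‖ * ‖(z + (t : ℂ) * c) ^ (p - 1)‖
          * ‖(starRingEnd ℂ z + (t : ℂ) * starRingEnd ℂ c) ^ (q - 1)‖
        ≤ 2 * (p : ℝ) * q * 1 * 1 * 1 * 1 := by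
          gcongr
          · exact norm_pow_le_one_of hw _
          · exact norm_pow_le_one_of hw' _
      _ = 2 * (p : ℝ) * q := by ring
  have e3 : ‖(q : ℂ) * ((q - 1 : ℕ) : ℂ) * starRingEnd ℂ c ^ 2 * (z + (t : ℂ) * c) ^ p
      * (starRingEnd ℂ z + (t : ℂ) * starRingEnd ℂ c) ^ (q - 1 - 1)‖ ≤ (q : ℝ) * q := by
    rw [norm_mul, norm_mul, norm_mul, norm_mul, Complex.norm_natCast, Complex.norm_natCast]
    calc (q : ℝ) * ((q - 1 : ℕ) : ℝ) * ‖starRingEnd ℂ c ^ 2‖ * ‖(z + (t : ℂ) * c) ^ p‖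
          * ‖(starRingEnd ℂ z + (t : ℂ) * starRingEnd ℂ c) ^ (q - 1 - 1)‖
        ≤ (q : ℝ) * q * 1 * 1 * 1 := by
          gcongr
          · exact norm_pow_le_one_of hc' 2
          · exact norm_pow_le_one_of hw _
          · exact norm_pow_le_one_of hw' _
      _ = (q : ℝ) * q := by ring
  calc _ ≤ (p : ℝ) * p + 2 * (p : ℝ) * q + (q : ℝ) * q := add_le_add (add_le_add e1 e2) e3
    _ = ((p : ℝ) + q) ^ 2 := by ring

/-- **The column identity at the centre:** summing the second derivatives along `1` and `I` at `t = 0`,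
`mpathD2 p q z 1 0 + mpathD2 p q z I 0 = 4 p q · z^{p−1} z̄^{q−1}` (the `c²` and `c̄²` terms cancel,
`1 + I² = 0`; the cross terms add) — `ConeMonomial.lapRI_monomial` for the explicit formulas.
[cite: ArioliKoch2019, §2 eqs. (2.7)–(2.10) (Δ = 4∂_z∂_z̄ on monomials)] -/
theorem mpathD2_one_add_I (p q : ℕ) (z : ℂ) :
    mpathD2 p q z 1 0 + mpathD2 p q z I 0
      = 4 * (p : ℂ) * (q : ℂ) * z ^ (p - 1) * (starRingEnd ℂ z) ^ (q - 1) := by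
  unfold mpathD2
  simp only [Complex.ofReal_zero, zero_mul, add_zero, map_one, one_pow, mul_one, Complex.conj_I]
  have hI : I ^ 2 = -1 := Complex.I_sq
  rw [neg_pow, hI]  -- (-I)^2 = (-1)^2 * I^2
  ring_nf
  rw [hI]
  ring

/-! ### §2. The column paths `t ↦ w_m(z + tc)`: derivatives and bounds -/

variable {ϱ : ℝ}

/-- The column function along a line: `w_m(z + tc)` in closed form (`(a,b) = idx m`).
[cite: ArioliKoch2019, §2 Lemma 2.1] -/
def colPath (m : Fin 2 →₀ ℕ) (z c : ℂ) (t : ℝ) : ℂ :=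
  (invFactor (idx m) : ℂ) * (mpath ((idx m).1 + 1) ((idx m).2 + 1) z c t
    - mpath (harmIndex (idx m)).1 (harmIndex (idx m)).2 z c t)

/-- Its first `t`-derivative. [cite: ArioliKoch2019, §2 Lemma 2.1] -/
def colPathD1 (m : Fin 2 →₀ ℕ) (z c : ℂ) (t : ℝ) : ℂ :=
  (invFactor (idx m) : ℂ) * (mpathD1 ((idx m).1 + 1) ((idx m).2 + 1) z c t
    - mpathD1 (harmIndex (idx m)).1 (harmIndex (idx m)).2 z c t)

/-- Its second `t`-derivative. [cite: ArioliKoch2019, §2 Lemma 2.1] -/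
def colPathD2 (m : Fin 2 →₀ ℕ) (z c : ℂ) (t : ℝ) : ℂ :=
  (invFactor (idx m) : ℂ) * (mpathD2 ((idx m).1 + 1) ((idx m).2 + 1) z c t
    - mpathD2 (harmIndex (idx m)).1 (harmIndex (idx m)).2 z c t)

/-- `colPath m z c t = w_m(z + tc)` (`ConeEval.colFun_eq`). [cite: ArioliKoch2019, §2 Lemma 2.1] -/
theorem colPath_eq_colFun (m : Fin 2 →₀ ℕ) (z c : ℂ) (t : ℝ) :
    colPath m z c t = colFun m (z + (t : ℂ) * c) := by
  rw [colFun_eq, colPath, mpath_eq, mpath_eq]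

/-- [cite: ArioliKoch2019, §2 Lemma 2.1] -/
theorem hasDerivAt_colPath (m : Fin 2 →₀ ℕ) (z c : ℂ) (t : ℝ) :
    HasDerivAt (colPath m z c) (colPathD1 m z c t) t :=
  ((hasDerivAt_mpath _ _ z c t).sub (hasDerivAt_mpath _ _ z c t)).const_mul _

/-- [cite: ArioliKoch2019, §2 Lemma 2.1] -/
theorem hasDerivAt_colPathD1 (m : Fin 2 →₀ ℕ) (z c : ℂ) (t : ℝ) :
    HasDerivAt (colPathD1 m z c) (colPathD2 m z c t) t :=
  ((hasDerivAt_mpathD1 _ _ z c t).sub (hasDerivAt_mpathD1 _ _ z c t)).const_mul _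

/-- The harmonic correction has total degree `|a − b| ≤ a + b`. [cite: ArioliKoch2019, §2 Lemma 2.1] -/
theorem harmIndex_deg_le (p : ℕ × ℕ) : (harmIndex p).1 + (harmIndex p).2 ≤ p.1 + p.2 := by
  unfold harmIndex; split_ifs <;> simp <;> omega

/-- The harmonic correction is a pure power of `z` or of `z̄`: the product of its exponents is `0`.
[cite: ArioliKoch2019, §2 Lemma 2.1 (Δ z^k = Δ z̄^k = 0)] -/
theorem harmIndex_mul_eq_zero (p : ℕ × ℕ) : (harmIndex p).1 * (harmIndex p).2 = 0 := by
  unfold harmIndex; split_ifs <;> simp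

/-- The key arithmetic fact `(a+1) + (b+1) ≤ 2(a+1)(b+1)`, i.e. `invFactor(a,b) · 2(a+b+2) ≤ 1`.
[cite: ArioliKoch2019, §2 Lemma 2.1 (size of the coefficients of Δ⁻¹)] -/
theorem invFactor_mul_deg_le (p : ℕ × ℕ) : invFactor p * (2 * ((p.1 : ℝ) + p.2 + 2)) ≤ 1 := by
  unfold invFactor
  have ha : (0 : ℝ) ≤ p.1 := Nat.cast_nonneg _
  have hb : (0 : ℝ) ≤ p.2 := Nat.cast_nonneg _
  rw [div_mul_eq_mul_div, one_mul, div_le_one (by positivity)]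
  nlinarith [mul_nonneg ha hb]

/-- **`|w_m(z+tc)| ≤ 1/2`** on the disk. [cite: ArioliKoch2019, §2 Lemma 2.1] -/
theorem norm_colPath_le (m : Fin 2 →₀ ℕ) {z c : ℂ} {t : ℝ} (hw : ‖z + (t : ℂ) * c‖ ≤ 1) :
    ‖colPath m z c t‖ ≤ 1 / 2 := by
  unfold colPath
  rw [norm_mul, Complex.norm_real, Real.norm_eq_abs, abs_of_pos (invFactor_pos _)]
  have h1 : ‖mpath ((idx m).1 + 1) ((idx m).2 + 1) z c t - mpath (harmIndex (idx m)).1 (harmIndex (idx m)).2 z c t‖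
      ≤ 2 := by
    refine (norm_sub_le _ _).trans ?_
    have e : ∀ p q, ‖mpath p q z c t‖ ≤ 1 := by
      intro p q
      rw [mpath_eq, monomial, norm_mul, norm_pow, norm_pow, Complex.norm_conj]
      calc ‖z + (t : ℂ) * c‖ ^ p * ‖z + (t : ℂ) * c‖ ^ q ≤ 1 * 1 :=
            mul_le_mul (pow_le_one₀ (norm_nonneg _) hw) (pow_le_one₀ (norm_nonneg _) hw)
              (pow_nonneg (norm_nonneg _) _) zero_le_one
        _ = 1 := one_mul 1
    linarith [e ((idx m).1 + 1) ((idx m).2 + 1), e (harmIndex (idx m)).1 (harmIndex (idx m)).2]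
  calc invFactor (idx m) * _ ≤ (1 / 4) * 2 :=
        mul_le_mul (invFactor_le _) h1 (norm_nonneg _) (by norm_num)
    _ = 1 / 2 := by norm_num

/-- **`|d/dt w_m(z+tc)| ≤ 1`** on the disk (`|c| ≤ 1`). [cite: ArioliKoch2019, §2 Lemma 2.1; §3 Lemma 3.1] -/
theorem norm_colPathD1_le (m : Fin 2 →₀ ℕ) {z c : ℂ} {t : ℝ} (hw : ‖z + (t : ℂ) * c‖ ≤ 1) (hc : ‖c‖ ≤ 1) :
    ‖colPathD1 m z c t‖ ≤ 1 := by
  unfold colPathD1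
  rw [norm_mul, Complex.norm_real, Real.norm_eq_abs, abs_of_pos (invFactor_pos _)]
  have hdeg := harmIndex_deg_le (idx m)
  have h1 : ‖mpathD1 ((idx m).1 + 1) ((idx m).2 + 1) z c t
      - mpathD1 (harmIndex (idx m)).1 (harmIndex (idx m)).2 z c t‖
      ≤ 2 * (((idx m).1 : ℝ) + (idx m).2 + 2) := by
    refine (norm_sub_le _ _).trans ?_
    have e1 := norm_mpathD1_le ((idx m).1 + 1) ((idx m).2 + 1) hw hc
    have e2 := norm_mpathD1_le (harmIndex (idx m)).1 (harmIndex (idx m)).2 hw hc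
    have hdeg' : ((harmIndex (idx m)).1 : ℝ) + (harmIndex (idx m)).2 ≤ (idx m).1 + (idx m).2 := by
      exact_mod_cast hdeg
    push_cast at e1
    linarith
  calc invFactor (idx m) * _ ≤ invFactor (idx m) * (2 * (((idx m).1 : ℝ) + (idx m).2 + 2)) :=
        mul_le_mul_of_nonneg_left h1 (invFactor_pos _).le
    _ ≤ 1 := invFactor_mul_deg_le _

/-- **`|d²/dt² w_m(z+tc)| ≤ a + b + 2`** on the disk (`|c| ≤ 1`; linear, not quadratic, growth in the degree
thanks to the factor `1/(4(a+1)(b+1))`). [cite: ArioliKoch2019, §2 Lemma 2.1; §3 Lemma 3.1] -/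
theorem norm_colPathD2_le (m : Fin 2 →₀ ℕ) {z c : ℂ} {t : ℝ} (hw : ‖z + (t : ℂ) * c‖ ≤ 1) (hc : ‖c‖ ≤ 1) :
    ‖colPathD2 m z c t‖ ≤ ((idx m).1 : ℝ) + (idx m).2 + 2 := by
  unfold colPathD2
  rw [norm_mul, Complex.norm_real, Real.norm_eq_abs, abs_of_pos (invFactor_pos _)]
  set A : ℝ := ((idx m).1 : ℝ) + (idx m).2 + 2 with hA
  have hA0 : 0 ≤ A := by rw [hA]; positivity
  have hdeg := harmIndex_deg_le (idx m)
  have h1 : ‖mpathD2 ((idx m).1 + 1) ((idx m).2 + 1) z c t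
      - mpathD2 (harmIndex (idx m)).1 (harmIndex (idx m)).2 z c t‖ ≤ 2 * A ^ 2 := by
    refine (norm_sub_le _ _).trans ?_
    have e1 := norm_mpathD2_le ((idx m).1 + 1) ((idx m).2 + 1) hw hc
    have e2 := norm_mpathD2_le (harmIndex (idx m)).1 (harmIndex (idx m)).2 hw hc
    have hdeg' : ((harmIndex (idx m)).1 : ℝ) + (harmIndex (idx m)).2 ≤ A := by
      have : ((harmIndex (idx m)).1 : ℝ) + (harmIndex (idx m)).2 ≤ (idx m).1 + (idx m).2 := by
        exact_mod_cast hdeg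
      rw [hA]; linarith
    have hh0 : 0 ≤ ((harmIndex (idx m)).1 : ℝ) + (harmIndex (idx m)).2 := by positivity
    have e1' : ‖mpathD2 ((idx m).1 + 1) ((idx m).2 + 1) z c t‖ ≤ A ^ 2 := by
      rw [hA]; push_cast at e1; nlinarith
    have e2' : ‖mpathD2 (harmIndex (idx m)).1 (harmIndex (idx m)).2 z c t‖ ≤ A ^ 2 :=
      e2.trans (pow_le_pow_left₀ hh0 hdeg' 2)
    linarith
  have hkey : invFactor (idx m) * (2 * A) ≤ 1 := by rw [hA]; exact invFactor_mul_deg_le _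
  calc invFactor (idx m) * _ ≤ invFactor (idx m) * (2 * A ^ 2) :=
        mul_le_mul_of_nonneg_left h1 (invFactor_pos _).le
    _ = invFactor (idx m) * (2 * A) * A := by ring
    _ ≤ 1 * A := mul_le_mul_of_nonneg_right hkey hA0
    _ = A := one_mul A

/-- **The column identity:** `∂²_t w_m(z+t)|₀ + ∂²_t w_m(z+tI)|₀ = z^a z̄^b` (`(a,b) = idx m`):
`Δ` of the raised monomial is `4(a+1)(b+1) z^a z̄^b`, `Δ` of the harmonic correction vanishes, and
`4(a+1)(b+1) · invFactor = 1`. [cite: ArioliKoch2019, §2 eqs. (2.7)–(2.10) and Lemma 2.1] -/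
theorem colPathD2_one_add_I (m : Fin 2 →₀ ℕ) (z : ℂ) :
    colPathD2 m z 1 0 + colPathD2 m z I 0 = mono m z := by
  unfold colPathD2
  rw [← mul_add, show ∀ a b c d : ℂ, (a - b) + (c - d) = (a + c) - (b + d) from fun a b c d => by ring,
    mpathD2_one_add_I, mpathD2_one_add_I]
  have hh : ((harmIndex (idx m)).1 : ℂ) * ((harmIndex (idx m)).2 : ℂ) = 0 := by
    rw [← Nat.cast_mul, harmIndex_mul_eq_zero, Nat.cast_zero]
  have hharm : 4 * ((harmIndex (idx m)).1 : ℂ) * ((harmIndex (idx m)).2 : ℂ)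
      * z ^ ((harmIndex (idx m)).1 - 1) * (starRingEnd ℂ z) ^ ((harmIndex (idx m)).2 - 1) = 0 := by
    rw [mul_assoc (4 : ℂ), hh]; ring
  rw [hharm, sub_zero, Nat.add_sub_cancel, Nat.add_sub_cancel, mono_eq, idx_apply]
  simp only
  have hf : (invFactor (m 0, m 1) : ℂ) * (4 * (((m 0 + 1 : ℕ) : ℂ)) * (((m 1 + 1 : ℕ) : ℂ))) = 1 := by
    unfold invFactor
    push_cast
    field_simp
  calc (invFactor (m 0, m 1) : ℂ) * (4 * ((m 0 + 1 : ℕ) : ℂ) * ((m 1 + 1 : ℕ) : ℂ) * z ^ (m 0)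
        * (starRingEnd ℂ z) ^ (m 1))
      = (invFactor (m 0, m 1) : ℂ) * (4 * ((m 0 + 1 : ℕ) : ℂ) * ((m 1 + 1 : ℕ) : ℂ))
          * (z ^ (m 0) * (starRingEnd ℂ z) ^ (m 1)) := by ring
    _ = z ^ (m 0) * (starRingEnd ℂ z) ^ (m 1) := by rw [hf, one_mul]

/-! ### §3. Growth of the degree against the weight (`ϱ > 1`) -/

/-- Bernoulli: `n + 2 ≤ (1/(ϱ−1) + 2) ϱ^n` for `ϱ > 1` — linear growth is dominated by the weight.
[cite: ArioliKoch2019, §3 Lemma 3.1 (ρ > 1 gives the extra regularity)] -/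
theorem deg_add_two_le_weight (hϱ : 1 < ϱ) (n : ℕ) :
    (n : ℝ) + 2 ≤ (1 / (ϱ - 1) + 2) * ϱ ^ n := by
  have hϱ0 : 0 < ϱ - 1 := sub_pos.2 hϱ
  have hB : 1 + (n : ℝ) * (ϱ - 1) ≤ (1 + (ϱ - 1)) ^ n := one_add_mul_le_pow (by linarith) n
  rw [add_sub_cancel] at hB
  have h1 : 1 ≤ ϱ ^ n := one_le_pow₀ hϱ.le
  have hn : (n : ℝ) ≤ 1 / (ϱ - 1) * ϱ ^ n := by
    rw [div_mul_eq_mul_div, one_mul, le_div_iff₀ hϱ0]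
    linarith
  linarith

end ConeEval

end Literature.Analysis.ValidatedNumerics
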